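import Summits.ABC.IUTFork.Cor312LicenceShallowConcreteDatum
import Summits.ABC.IUTFork.Cor312LicenceShallowRealising
import Summits.ABC.IUTFork.Cor312PilotIdelesPrCapstone
import HarnessLib

/-!
# [IUTchIII] Cor. 3.12 — a CONCRETE pilot datum on the INHABITED side of the tame depth dichotomy, part 2 (the licence):
# at `X75 = (ℚ(⁵√7), 7⁻², V₇, 5)` the (xi-f) licence, branch C's antecedent and the typed Statement hold for realising ideles

PROOF-ONLY record file (D-0012; 0 definitions, 0 `Prop` facts) of the abc-iut cell (block C / W6 cone prover abc-iut-w6-d114,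
gen 4; row «LICENCE-SHALLOW-CONCRETE-DATUM», sequel of the definition-bearing part 1 `Cor312LicenceShallowConcreteDatum`).
TAKES NO SIDE on [IUTchIII] Cor. 3.12 or on any author: every statement is about OUR typed objects — abc-iut-c312-7's
print-normalised sharp real setting `Real.settingPrVolSharp` / abc-iut-c312-3's `Real.settingDHVolSharp` over abc-iut-c312-5's
Dupuy–Hilado-level real log-shells, sharp Θ-boxes and `q`-centres read off ideles REALISING `P_Θ`, `P_q` (Dupuy–Hilado (3.4)),
Dupuy–Hilado's typed (Ind1)/(Ind2).

Part 1 built the datum `X75` (`F75 = ℚ(⁵√7)`, `j_E = 7⁻²`, `S = V(F75)₇` — one place, `e = 5`, `f = 1`, tame —, `l = 5`,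
`P_q(v) = 1`) and discharged the two arithmetic binders `htame`, `hdeg` of abc-iut-w5-d236's
`exists_qPinned_and_hull_settingPrVolSharp_of_realises_shallow` (p439445). THIS FILE composes:

* §4 **`licence_settingPrVolSharp_concreteDatum`** / `…settingDHVolSharp…`, **`exists_qPinned_and_hull_settingPrVolSharp_concreteDatum`**
  — at `X75`, for EVERY family of realising ideles and every structural binder of the sharp setting, the (xi-f) `Licence` and
  branch C's «`∃ ρ qK, QPinned ∧ PilotKummerCompatHull`» hold, with NO arithmetic hypothesis left; hence (abc-iut-c312-1's
  `statement_of_licence` + abc-iut-c312-7's `bridgeHyps_settingPrVolSharp_of_ideles` / `statement_settingPrVolSharp_iff`)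
  **`statement_settingPrVolSharp_concreteDatum`** — the typed `Statement` of Cor. 3.12 at that setting — and the Θ-side inequality
  **`thetaSide_settingPrVolSharp_concreteDatum(_explicit)`**: `−(ln 7)/5 ≤ −|log Θ|`.
* §5 **`exists_realising_ideles_licence_concreteDatum`** — packaged NON-VACUITY: with the analytic logarithms `analyticLogv F75`
  there EXIST realising ideles `t_q`, `t_Θ` (non-zero, units off `S`; abc-iut-c312-3 / `Cor312Prov.exists_realising_…`) such that,
  for every structural binder, the `Licence` and the typed `Statement` hold and branch C's antecedent is inhabited at
  `settingPrVolSharp X75 …`.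

READING (neutral; numbers, not adjectives). A concrete number-field pilot datum on the INHABITED side of the cell's tame depth
dichotomy for the hull-level licence (refuted side: every datum over `ℚ`, p437693 / `Cor312LicenceSharpRat`; deep data,
`Cor312NotLicencePrVolSharpRealises`). The typed `Statement` at ONE shallow PilotData-level point (`|log(q)| = (ln 7)/5`) carries no
Diophantine content and says nothing about the printed corollary in general; K-level / initial-Θ-data genuineness (abc-iut-C-cert-3
v5K) is NOT claimed. HONEST SCOPE as in the parents: OUR typed sharp containers and Dupuy–Hilado's typed (Ind2); the licence is a
STRONGER-THAN-PRINT set-level form; nothing about the printed GLOBAL inequality; nothing asserts or refutes [IUTchIII] Cor. 3.12.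
[cite: DupuyHilado2025, §3.3, §3.4, §3.9, §4.9] [cite: Mochizuki2012, IUTchI Ex. 3.2 (iv) p. 71]
[claim: Mochizuki2012, status: disputed] for every IUT sentence quoted. typed ≠ proved; instantiated ≠ endorsed.
-/

noncomputable section

/-! ## §4. The licence and branch C's antecedent at the concrete datum, for every family of realising ideles -/

namespace Summit.ABC.IUTFork.Thm311.Real

open Set Metric Function NumberField IsDedekindDomain
open Cor312 Cor312.Setting Cor312Vol Literature.IUT.LogThetaLattice Literature.IUT.LogVolume
open Literature.NumberTheory.NumberFields Literature.NumberTheory.GaloisRepresentations.Ultrametric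
open Summit.ABC.IUTFork.ConcreteDatum

variable {logv : PadicLogs ↥F75} (hlog : LogvAnalytic logv)
  (M : Type) [Field M] [NumberField M]
  (archPk : ∀ (j : (thetaIndex X75).Label) (vQ : (thetaIndex X75).VQ), Set ((logShellsDH X75 logv).Packet j vQ))
  (archSub : ∀ (j : (thetaIndex X75).Label) (v : (thetaIndex X75).V),
    Set ((logShellsDH X75 logv).Packet j ((thetaIndex X75).over v)))
  (Ψ : ℤ → ∀ v : (thetaIndex X75).V, v ∈ (thetaIndex X75).Vbad → Set ((logShellsDH X75 logv).StarPacket v))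
  (act : ℤ → ∀ v : (thetaIndex X75).V, v ∈ (thetaIndex X75).Vbad →
    (logShellsDH X75 logv).StarPacket v → Module.End ℚ ((logShellsDH X75 logv).StarPacket v))
  (Mmod : ℤ → ∀ j : (thetaIndex X75).LabelStar, Set ((logShellsDH X75 logv).GlobalPacket j.1))
  (region : ℤ → ∀ j : (thetaIndex X75).LabelStar, FinDivisor M → ∀ vQ : (thetaIndex X75).VQ,
    Set ((logShellsDH X75 logv).Packet j.1 vQ))
  (n : ℤ) {HT : Type} {LogLink : HT → HT → Type} {IsFull : ∀ {s t : HT}, LogLink s t → Prop}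
  (lat : LGPGaussianLogThetaLattice LogLink IsFull)
  {Frd : Type} {IsoF : Frd → Frd → Type} {Ob : Frd → Type} {realify : Frd → Frd} {Strip : Type}
  {IsoS : Strip → Strip → Type} {Mv : ∀ v : (thetaIndex X75).V, v ∈ (thetaIndex X75).Vbad → Type}
  [∀ v h, Monoid (Mv v h)]
  (sig : GlobalLGPFrobenioidSignature (thetaIndex X75).lstar (thetaIndex X75).V (· ∈ (thetaIndex X75).Vbad)
    Frd IsoF Ob realify Strip IsoS Mv)
  (split : SplittingMonoids Mv) {ObΔ : Type} {N : ∀ v : (thetaIndex X75).V, v ∈ (thetaIndex X75).Vbad → Type}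
  [∀ v h, Monoid (N v h)] (qData : QPilotData ObΔ N)
  (tq : ∀ (pp : Nat.Primes) (x : (thetaIndex X75).Fibre (.inr pp)), haveI : Fact (pp : ℕ).Prime := ⟨pp.2⟩; kOf X75 pp.1 x)
  (t : ∀ (pp : Nat.Primes) (_ : Fin X75.lstar) (x : (thetaIndex X75).Fibre (.inr pp)),
    haveI : Fact (pp : ℕ).Prime := ⟨pp.2⟩; kOf X75 pp.1 x)
  (htq0 : ∀ pp x, tq pp x ≠ 0)
  (htq1 : ∀ (pp : Nat.Primes) (x : (thetaIndex X75).Fibre (.inr pp)),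
    haveI : Fact (pp : ℕ).Prime := ⟨pp.2⟩; placeOf X75 pp.1 x ∉ X75.S → ‖tq pp x‖ = 1)
  (col : ℤ → Column (logShellsDH X75 logv))
  (ht0 : ∀ pp i x, t pp i x ≠ 0)
  (ht : ∀ (pp : Nat.Primes) (i : Fin X75.lstar) (x : (thetaIndex X75).Fibre (.inr pp)),
    haveI : Fact (pp : ℕ).Prime := ⟨pp.2⟩
    Real.log ‖t pp i x‖ = -(X75.thetaPilot i (placeOf X75 pp.1 x)) * logNorm ↥F75 (placeOf X75 pp.1 x) /
      localDegree ↥F75 (placeOf X75 pp.1 x))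
  (htq : ∀ (pp : Nat.Primes) (x : (thetaIndex X75).Fibre (.inr pp)),
    haveI : Fact (pp : ℕ).Prime := ⟨pp.2⟩
    Real.log ‖tq pp x‖ = -(X75.qPilot (placeOf X75 pp.1 x)) * logNorm ↥F75 (placeOf X75 pp.1 x) /
      localDegree ↥F75 (placeOf X75 pp.1 x))

include ht0 ht htq in
/-- **THE (xi-f) LICENCE AT `settingDHVolSharp X75 …` FOR EVERY FAMILY OF REALISING IDELES — no arithmetic hypothesis**
(abc-iut-w5-d236's `licence_settingDHVolSharp_of_realises_shallow` with `htame`, `hdeg` discharged by §2–§3).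
[cite: DupuyHilado2025, §3.4, §3.9, §4.9] [claim: Mochizuki2012, status: disputed] -/
theorem licence_settingDHVolSharp_concreteDatum :
    Thm311ToCor312.Licence (settingDHVolSharp X75 hlog M archPk archSub Ψ act Mmod region n lat sig split qData tq t htq0 htq1) :=
  licence_settingDHVolSharp_of_realises_shallow X75 hlog M archPk archSub Ψ act Mmod region n lat sig split qData tq t htq0 htq1
    ht0 ht htq htame_X75 hdeg_X75

include ht0 ht htq in
/-- **THE (xi-f) LICENCE AT THE PRINT-NORMALISED SHARP SETTING `settingPrVolSharp X75 …` FOR EVERY FAMILY OF REALISING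
IDELES — no arithmetic hypothesis.** [cite: DupuyHilado2025, §3.4, §3.9, §4.9] [claim: Mochizuki2012, status: disputed] -/
theorem licence_settingPrVolSharp_concreteDatum :
    Thm311ToCor312.Licence (settingPrVolSharp X75 hlog M archPk archSub Ψ act Mmod region n lat sig split qData tq t htq0 htq1) :=
  licence_settingPrVolSharp_of_realises_shallow X75 hlog M archPk archSub Ψ act Mmod region n lat sig split qData tq t htq0 htq1
    ht0 ht htq htame_X75 hdeg_X75

include ht0 ht htq in
/-- **BRANCH C's ANTECEDENT «`∃ ρ qK, QPinned ∧ PilotKummerCompatHull`» IS INHABITED at `settingPrVolSharp X75 …` for every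
family of realising ideles and every column structure — no arithmetic hypothesis.** With abc-iut-C-cert-1's
`thetaSide_of_exists_qPinned_and_hull_settingPrVolSharp` the typed Θ-side inequality follows there.
[cite: DupuyHilado2025, §3.4, §3.9, §4.9] [claim: Mochizuki2012, status: disputed] -/
theorem exists_qPinned_and_hull_settingPrVolSharp_concreteDatum :
    ∃ (ρ : (∀ v : (thetaIndex X75).V, v ∈ (thetaIndex X75).Vbad → Set ((logShellsDH X75 logv).StarPacket v)) →
          ∀ (j : (thetaIndex X75).Label) (vQ : (thetaIndex X75).VQ), Set ((logShellsDH X75 logv).Packet j vQ))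
        (qK : ∀ v : (thetaIndex X75).V, v ∈ (thetaIndex X75).Vbad → Set ((logShellsDH X75 logv).StarPacket v)),
        QPinned ({ toSituation := situationPrVol X75 hlog M archPk archSub Ψ act Mmod region, col := col } :
            LatticeSituation (thetaIndex X75))
          (settingPrVolSharp X75 hlog M archPk archSub Ψ act Mmod region n lat sig split qData tq t htq0 htq1) ρ qK ∧
        PilotKummerCompatHull ({ toSituation := situationPrVol X75 hlog M archPk archSub Ψ act Mmod region, col := col } :
            LatticeSituation (thetaIndex X75))
          (settingPrVolSharp X75 hlog M archPk archSub Ψ act Mmod region n lat sig split qData tq t htq0 htq1) ρ qK :=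
  exists_qPinned_and_hull_settingPrVolSharp_of_realises_shallow X75 hlog M archPk archSub Ψ act Mmod region n lat sig split
    qData tq t htq0 htq1 col ht0 ht htq htame_X75 hdeg_X75

include ht0 ht htq in
/-- **THE TYPED `Statement` OF [IUTchIII] COR. 3.12 AT `settingPrVolSharp X75 …` FOR EVERY FAMILY OF REALISING IDELES**
(abc-iut-c312-1's `Thm311ToCor312.statement_of_licence`: `BridgeHyps` — abc-iut-c312-7's `bridgeHyps_settingPrVolSharp_of_ideles`,
Θ-ideles units off `S` by `norm_eq_one_of_realises` — plus §4's licence). HONEST READING: one PilotData-level point with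
`|log(q)| = (ln 7)/5` in the sharp Dupuy–Hilado reading; no Diophantine content, nothing about the printed corollary in general.
[cite: DupuyHilado2025, §3.4, §3.9, §4.9] [claim: Mochizuki2012, status: disputed] -/
theorem statement_settingPrVolSharp_concreteDatum :
    (settingPrVolSharp X75 hlog M archPk archSub Ψ act Mmod region n lat sig split qData tq t htq0 htq1).Statement :=
  Thm311ToCor312.statement_of_licence
    (bridgeHyps_settingPrVolSharp_of_ideles X75 hlog M archPk archSub Ψ act Mmod region n lat sig split qData t tq ht0
      (fun pp i x hx => norm_eq_one_of_realises X75 t ht0 ht pp i x hx) htq0 htq1)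
    (licence_settingPrVolSharp_concreteDatum hlog M archPk archSub Ψ act Mmod region n lat sig split qData tq t htq0 htq1 ht0 ht htq)

include ht0 ht htq in
/-- **THE TYPED Θ-SIDE INEQUALITY OF COR. 3.12 AT THE CONCRETE DATUM**, `↑(−deĝ̲(P_q)) ≤ −|log Θ|` at `settingPrVolSharp X75 …`,
for every family of realising ideles and every structural binder (abc-iut-c312-7's `statement_settingPrVolSharp_iff`).
[cite: DupuyHilado2025, §3.4, §3.9, §4.9] [claim: Mochizuki2012, status: disputed] -/
theorem thetaSide_settingPrVolSharp_concreteDatum :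
    (((-FinDivisor.ndeg ↥F75 X75.qPilot : ℝ)) : WithTop ℝ) ≤
      (settingPrVolSharp X75 hlog M archPk archSub Ψ act Mmod region n lat sig split qData tq t htq0 htq1).negLogTheta :=
  (statement_settingPrVolSharp_iff X75 hlog M archPk archSub Ψ act Mmod region n lat sig split qData t tq ht0
      (fun pp i x hx => norm_eq_one_of_realises X75 t ht0 ht pp i x hx) htq0 htq1 htq).1
    (statement_settingPrVolSharp_concreteDatum hlog M archPk archSub Ψ act Mmod region n lat sig split qData tq t htq0 htq1 ht0
      ht htq)

include ht0 ht htq in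
/-- **The same with the number filled in: `−(ln 7)/5 ≤ −|log Θ|`** at `settingPrVolSharp X75 …` (`deĝ̲(P_q) = (ln 7)/5`,
`ndeg_qPilot_X75`). [cite: DupuyHilado2025, §3.3, §3.4] [claim: Mochizuki2012, status: disputed] -/
theorem thetaSide_settingPrVolSharp_concreteDatum_explicit :
    (((-(Real.log 7 / 5) : ℝ)) : WithTop ℝ) ≤
      (settingPrVolSharp X75 hlog M archPk archSub Ψ act Mmod region n lat sig split qData tq t htq0 htq1).negLogTheta := by
  rw [← ndeg_qPilot_X75]
  exact thetaSide_settingPrVolSharp_concreteDatum hlog M archPk archSub Ψ act Mmod region n lat sig split qData tq t htq0 htq1 ht0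
    ht htq

end Summit.ABC.IUTFork.Thm311.Real

/-! ## §5. Packaged non-vacuity: realising ideles EXIST at `X75`, and for them the licence holds -/

namespace Summit.ABC.IUTFork.Thm311.Real

open Set Metric Function NumberField IsDedekindDomain
open Cor312 Cor312.Setting Cor312Vol Literature.IUT.LogThetaLattice Literature.IUT.LogVolume
open Literature.NumberTheory.NumberFields Literature.NumberTheory.GaloisRepresentations.Ultrametric
open Summit.ABC.IUTFork.ConcreteDatum

/-- **NON-VACUITY AT THE CONCRETE DATUM, PACKAGED.** With the analytic logarithms `analyticLogv F75` there EXIST q- and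
Θ-ideles on the completions of `F75 = ℚ(⁵√7)` that are non-zero, units off `S = V(F75)₇`, and REALISE `P_q`, `P_Θ` of `X75`
in Dupuy–Hilado's normalisation (3.4) (abc-iut-c312-3 / `Cor312Prov.exists_realising_{q,theta}Ideles_of_twoMulLDvdOrdq`,
available since `2l = 10 ∣ ord_v(q_v) = 10`), such that for EVERY structural binder of the print-normalised sharp setting
(auxiliary field `M`, archimedean packets, procession data, log-theta-lattice, Frobenioid signature, splitting monoids,
q-pilot data, columns) the (xi-f) `Licence` holds at `settingPrVolSharp X75 …`, the typed `Statement` of Cor. 3.12 holds there,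
AND branch C's antecedent «`∃ ρ qK, QPinned ∧ PilotKummerCompatHull`» is inhabited there. [cite: DupuyHilado2025, §3.3, §3.4, §3.9, §4.9]
[cite: Mochizuki2012, IUTchI Ex. 3.2 (iv) p. 71] [claim: Mochizuki2012, status: disputed] -/
theorem exists_realising_ideles_licence_concreteDatum :
    ∃ (tq : ∀ (pp : Nat.Primes) (x : (thetaIndex X75).Fibre (.inr pp)), haveI : Fact (pp : ℕ).Prime := ⟨pp.2⟩; kOf X75 pp.1 x)
      (t : ∀ (pp : Nat.Primes) (_ : Fin X75.lstar) (x : (thetaIndex X75).Fibre (.inr pp)),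
        haveI : Fact (pp : ℕ).Prime := ⟨pp.2⟩; kOf X75 pp.1 x)
      (htq0 : ∀ pp x, tq pp x ≠ 0)
      (htq1 : ∀ (pp : Nat.Primes) (x : (thetaIndex X75).Fibre (.inr pp)),
        haveI : Fact (pp : ℕ).Prime := ⟨pp.2⟩; placeOf X75 pp.1 x ∉ X75.S → ‖tq pp x‖ = 1),
      (∀ pp i x, t pp i x ≠ 0) ∧
      (∀ (pp : Nat.Primes) (i : Fin X75.lstar) (x : (thetaIndex X75).Fibre (.inr pp)),
          haveI : Fact (pp : ℕ).Prime := ⟨pp.2⟩; placeOf X75 pp.1 x ∉ X75.S → ‖t pp i x‖ = 1) ∧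
      (∀ (pp : Nat.Primes) (i : Fin X75.lstar) (x : (thetaIndex X75).Fibre (.inr pp)),
          haveI : Fact (pp : ℕ).Prime := ⟨pp.2⟩
          Real.log ‖t pp i x‖ = -(X75.thetaPilot i (placeOf X75 pp.1 x)) * logNorm ↥F75 (placeOf X75 pp.1 x) /
            localDegree ↥F75 (placeOf X75 pp.1 x)) ∧
      (∀ (pp : Nat.Primes) (x : (thetaIndex X75).Fibre (.inr pp)),
          haveI : Fact (pp : ℕ).Prime := ⟨pp.2⟩
          Real.log ‖tq pp x‖ = -(X75.qPilot (placeOf X75 pp.1 x)) * logNorm ↥F75 (placeOf X75 pp.1 x) /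
            localDegree ↥F75 (placeOf X75 pp.1 x)) ∧
      ∀ (M : Type) [Field M] [NumberField M]
        (archPk : ∀ (j : (thetaIndex X75).Label) (vQ : (thetaIndex X75).VQ),
          Set ((logShellsDH X75 (analyticLogv ↥F75)).Packet j vQ))
        (archSub : ∀ (j : (thetaIndex X75).Label) (v : (thetaIndex X75).V),
          Set ((logShellsDH X75 (analyticLogv ↥F75)).Packet j ((thetaIndex X75).over v)))
        (Ψ : ℤ → ∀ v : (thetaIndex X75).V, v ∈ (thetaIndex X75).Vbad →
          Set ((logShellsDH X75 (analyticLogv ↥F75)).StarPacket v))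
        (act : ℤ → ∀ v : (thetaIndex X75).V, v ∈ (thetaIndex X75).Vbad →
          (logShellsDH X75 (analyticLogv ↥F75)).StarPacket v →
            Module.End ℚ ((logShellsDH X75 (analyticLogv ↥F75)).StarPacket v))
        (Mmod : ℤ → ∀ j : (thetaIndex X75).LabelStar, Set ((logShellsDH X75 (analyticLogv ↥F75)).GlobalPacket j.1))
        (region : ℤ → ∀ j : (thetaIndex X75).LabelStar, FinDivisor M → ∀ vQ : (thetaIndex X75).VQ,
          Set ((logShellsDH X75 (analyticLogv ↥F75)).Packet j.1 vQ))
        (n : ℤ) (HT : Type) (LogLink : HT → HT → Type) (IsFull : ∀ {s t : HT}, LogLink s t → Prop)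
        (lat : LGPGaussianLogThetaLattice LogLink IsFull)
        (Frd : Type) (IsoF : Frd → Frd → Type) (Ob : Frd → Type) (realify : Frd → Frd) (Strip : Type)
        (IsoS : Strip → Strip → Type) (Mv : ∀ v : (thetaIndex X75).V, v ∈ (thetaIndex X75).Vbad → Type)
        (_ : ∀ v h, Monoid (Mv v h))
        (sig : GlobalLGPFrobenioidSignature (thetaIndex X75).lstar (thetaIndex X75).V (· ∈ (thetaIndex X75).Vbad)
          Frd IsoF Ob realify Strip IsoS Mv)
        (split : SplittingMonoids Mv) (ObΔ : Type) (N : ∀ v : (thetaIndex X75).V, v ∈ (thetaIndex X75).Vbad → Type)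
        (_ : ∀ v h, Monoid (N v h)) (qData : QPilotData ObΔ N)
        (col : ℤ → Column (logShellsDH X75 (analyticLogv ↥F75))),
        Thm311ToCor312.Licence (settingPrVolSharp X75 (logvAnalytic_analyticLogv (F := ↥F75)) M archPk archSub Ψ act Mmod
            region n lat sig split qData tq t htq0 htq1) ∧
        (settingPrVolSharp X75 (logvAnalytic_analyticLogv (F := ↥F75)) M archPk archSub Ψ act Mmod
            region n lat sig split qData tq t htq0 htq1).Statement ∧
        ∃ (ρ : (∀ v : (thetaIndex X75).V, v ∈ (thetaIndex X75).Vbad →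
                Set ((logShellsDH X75 (analyticLogv ↥F75)).StarPacket v)) →
              ∀ (j : (thetaIndex X75).Label) (vQ : (thetaIndex X75).VQ),
                Set ((logShellsDH X75 (analyticLogv ↥F75)).Packet j vQ))
          (qK : ∀ v : (thetaIndex X75).V, v ∈ (thetaIndex X75).Vbad →
            Set ((logShellsDH X75 (analyticLogv ↥F75)).StarPacket v)),
          QPinned ({ toSituation := (situationPrVol X75 (logvAnalytic_analyticLogv (F := ↥F75)) M archPk archSub Ψ act Mmod
                region), col := col } : LatticeSituation (thetaIndex X75))
            (settingPrVolSharp X75 (logvAnalytic_analyticLogv (F := ↥F75)) M archPk archSub Ψ act Mmod region n lat sig split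
              qData tq t htq0 htq1) ρ qK ∧
          PilotKummerCompatHull ({ toSituation := (situationPrVol X75 (logvAnalytic_analyticLogv (F := ↥F75)) M archPk archSub
                Ψ act Mmod region), col := col } : LatticeSituation (thetaIndex X75))
            (settingPrVolSharp X75 (logvAnalytic_analyticLogv (F := ↥F75)) M archPk archSub Ψ act Mmod region n lat sig split
              qData tq t htq0 htq1) ρ qK := by
  obtain ⟨tq, htq0, htq1, htq⟩ := Cor312Prov.exists_realising_qIdeles_of_twoMulLDvdOrdq X75 twoMulLDvdOrdq_X75
  obtain ⟨t, ht0, ht1, ht⟩ := Cor312Prov.exists_realising_thetaIdeles_of_twoMulLDvdOrdq X75 twoMulLDvdOrdq_X75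
  refine ⟨tq, t, htq0, htq1, ht0, ht1, ht, htq, ?_⟩
  intro M _ _ archPk archSub Ψ act Mmod region n HT LogLink IsFull lat Frd IsoF Ob realify Strip IsoS Mv _ sig split ObΔ N _
    qData col
  exact ⟨licence_settingPrVolSharp_concreteDatum (logvAnalytic_analyticLogv (F := ↥F75)) M archPk archSub Ψ act Mmod region n
      lat sig split qData tq t htq0 htq1 ht0 ht htq,
    statement_settingPrVolSharp_concreteDatum (logvAnalytic_analyticLogv (F := ↥F75)) M archPk archSub Ψ act Mmod region n
      lat sig split qData tq t htq0 htq1 ht0 ht htq,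
    exists_qPinned_and_hull_settingPrVolSharp_concreteDatum (logvAnalytic_analyticLogv (F := ↥F75)) M archPk archSub Ψ act Mmod
      region n lat sig split qData tq t htq0 htq1 col ht0 ht htq⟩

end Summit.ABC.IUTFork.Thm311.Real

end
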